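import Summits.HodgeConjecture.HodgeConjecture.Theorems.F0P3cStCharTSTubeSubsetSandwich   -- ★ (J4c) (this seat): §1 (L1) forward `valuation_heisX/Y_le_of_mem`; brings ★ (J3)(J3⁻), ★ Iwahori factorisation, ★ (L5) commutators
import HarnessLib

/-!
# F0 · P3c · line LH6 «StCharTS» — ROAD «JAC-LOC» brick (J5b) «NEWTON STEP»: an approximate solution of `k s τ k⁻¹ = g` at level `δ` is refined to level
# `μ·γ` (`μ ≈ δ∕(root-unit sizes of s)`), for a REGULAR split-torus element `s` of `U(Φ₃)(K)` (Harish-Chandra 1970 Lemma 22; van Dijk 1972 §2)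

Cell `pub/hodgecm-mathlib`, crux H413 = `stmt-HodgeConjecture-24833` (lane `--supports … --as helper`), route HCCMUnconditional; seat LH6-p03 (g5), holder of the road
«JAC-LOC» (memo `F0/P3b/LH6-p03/g5/ROAD-JAC-LOC.v2.LH6p03g5.md` §5 «PLAN v2», CLAIM B).  THEOREMS ONLY, sorry-free, no definition ∕ instance ∕ notation ∕ named fact.

SETTING = ★ (J4c)'s (the model `U = U(σ, Φ₃)(K)`, `K` a field with a valuative relation `v = valuation K`, `σ` an isometric involution, `2 ∈ Kˣ`; levels
`K_δ := (congruenceGL 3 δ).comap U.subtype`, `w₀ = weylLongU σ hJ`, `T = torusU σ J`, `N = unipotentU σ J`, regular `s = diag(d) ∈ T` with root scalars `a = d₀⁻¹d₁`,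
`b = d₀⁻¹d₂`, `a_w = d₂⁻¹d₁`, `b_w = d₂⁻¹d₀`; twists `ψ_s(g) = s⁻¹ g s g⁻¹`).

THE NEWTON STEP **`exists_refine_conj_approx`**.  Let `k ∈ K_γ`, `τ ∈ T ∩ K_γ` and an ERROR `e ∈ K_δ` (`δ < 1`, `v(½)δ ≤ 1`).  Choose radii `ρx ρy ρ̄x ρ̄y ≤ μ ≤ γ` with
`v(a−1)ρx = v(b−1)ρy = δ = v(a_w−1)ρ̄x = v(b_w−1)ρ̄y` (so the twists map the boxes of these radii ONTO the level-`δ` boxes, ★ (J3)(J3⁻)) satisfying the two depth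
conditions, and suppose the REVERSE level inclusion `hL1rev : BOX(η, η) ⊆ K_η` for `v(½)η ≤ 1` ((L1), ★ (J2)) and `δ ≤ μ`.  Then there are `k′ ∈ K_γ`, `τ′ ∈ T ∩ K_γ` with
  **`(k′ s τ′ k′⁻¹)⁻¹ · (k s τ k⁻¹ · e) ∈ K_{μ·γ}`**
— the error improves from `δ` to `μγ = (γ∕ρ)·δ` (`ρ` = the least root-unit size), a CONTRACTION once `γ < ρ`.  CONSTRUCTION (memo CLAIM B): `e′ := k⁻¹ e k = ē τ_e n_e` (Iwahori at
level `δ`, ★ `exists_nbar_unipotent_eq_of_mem` form), `ē₂ := τ_e⁻¹ ē τ_e`; `n₁ ∈ BOX(ρx, ρy)` with `ψ_s(n₁) = n_e` and `n̄₁ = w₀ m₁ w₀⁻¹`, `m₁ ∈ BOX(ρ̄x, ρ̄y)`, with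
`ψ_s(n̄₁) = ē₂` (★ surjOn of (J3)(J3⁻)); `m₃ := n̄₁ n₁ ∈ K_μ`, `k′ := k m₃`, `τ′ := τ τ_e`.  VERIFICATION (free-group identities, NO conjugation by `s` of anything
unknown — so COMPACT and NON-compact `s` alike): with `c := ττ_e`, `(k′sτ′k′⁻¹)⁻¹(ksτk⁻¹e) = k·[ψ_{sc}(m₃)⁻¹ · ē₂ n_e]·k⁻¹` (`newton_bracket_eq`),
`ψ_{sc}(m₃) = (c⁻¹ψ_s(m₃)c)·(c⁻¹m₃cm₃⁻¹) = ψ_s(m₃)·j₄·j₅` (`j₄ ∈ K_{γδ}`, `j₅ ∈ K_{γμ}`, ★ (L5)), `ψ_s(m₃) = ψ_s(n̄₁)·(n̄₁ψ_s(n₁)n̄₁⁻¹) = ē₂·n_e·j₂` (`j₂ ∈ K_{μδ}`),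
so the bracket is `j₅⁻¹ j₄⁻¹ j₂⁻¹ ∈ K_{μγ}` (needs `δ ≤ μ ≤ γ ≤ 1`), and conjugation by `k ∈ K_γ` preserves `K_{μγ}`.

* §1 `twist_mul_eq` — `ψ_s(g h) = ψ_s(g) · (g ψ_s(h) g⁻¹)`; `newton_bracket_eq`; `twist_mul_right_eq` — `ψ_{sc}(m) = (c⁻¹ψ_s(m)c)(c⁻¹mcm⁻¹)` (group identities).
* §2 `exists_refine_conj_approx` — the Newton step.
* §3 `exists_conj_approx_base` — the base case: every `s·(b̄ c b e)` is hit at level `ε`.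

HONEST LABEL: count-neutral algebra for the road «JAC-LOC» (hyperbolic half of the print residue «WIF» of the (S-𝔇) organ `stub_EllipticPackage`); closes no organ.
HC_CM is proved only modulo the 7 printed citations (2 remaining: hLiu418 = `stmt-HodgeConjecture-24832`, h413 = `stmt-HodgeConjecture-24833`) until rung 0 closes.

## References
* [HarishChandra1970] Harish-Chandra, *Harmonic analysis on reductive p-adic groups*, LNM 162 (1970), Lemma 22 (the submersivity of `(x, t) ↦ x t x⁻¹`).
* [vanDijk1972] G. van Dijk, *Computation of certain induced characters of p-adic groups*, Math. Ann. 199 (1972) 229–240, §2.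
* [Casselman1995] W. Casselman, *Introduction to the theory of admissible representations of p-adic reductive groups* (1995), Prop. 1.4.4.
* [Rogawski1990] J. D. Rogawski, *Automorphic Representations of Unitary Groups in Three Variables*, Ann. of Math. Stud. 123 (1990), §12.5 p. 182.
-/

set_option autoImplicit false
-- the mandated namespace has the single-problem summit's repeated segment (`HodgeConjecture.HodgeConjecture`)
set_option linter.dupNamespace false

open Matrix ValuativeRel
open Literature.NumberTheory.Automorphic Literature.NumberTheory.Automorphic.UnitaryGroup Literature.NumberTheory.Automorphic.UnitaryGroup.HeisRing
open Literature.NumberTheory.Rogawski1990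
open Summit.HodgeConjecture.HodgeConjecture.Cruxes.H413.F0P3cStCharTSTorusUnipotentConj
open Summit.HodgeConjecture.HodgeConjecture.Cruxes.H413.F0P3cStCharTSVanDijkBox
open Summit.HodgeConjecture.HodgeConjecture.Cruxes.H413.F0P3cStCharTSVanDijkBoxOpp
open Summit.HodgeConjecture.HodgeConjecture.Cruxes.H413.F0P3cStCharTSTubeSubsetSandwich
open scoped MatrixGroups Pointwise

namespace Summit.HodgeConjecture.HodgeConjecture.Cruxes.H413.F0P3cStCharTSTubeNewtonStep

variable {K : Type*} [Field K] [ValuativeRel K] (σ : K →+* K) (hσ : ∀ x, σ (σ x) = x) [Invertible (2 : K)]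
  {J : Matrix (Fin 3) (Fin 3) K} (hJ : J = (StdForm.antidiagonal 3).over K)

/-! ## §1 Group identities for the twist `ψ_s(g) = s⁻¹ g s g⁻¹` -/

omit [ValuativeRel K] [Invertible (2 : K)] in
/-- **`ψ_s(g h) = ψ_s(g) · (g ψ_s(h) g⁻¹)`** (free-group identity). [cite: vanDijk1972, §2] -/
theorem twist_mul_eq (s g h : ↥(unitaryGroupOfForm σ J)) :
    s⁻¹ * (g * h) * s * (g * h)⁻¹ = (s⁻¹ * g * s * g⁻¹) * (g * (s⁻¹ * h * s * h⁻¹) * g⁻¹) := by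
  group

omit [ValuativeRel K] [Invertible (2 : K)] in
/-- **The Newton bracket** (free-group identity): with `e′ = ē τ_e n_e` and `τ_e ē₂ = ē τ_e`,
`(k m s (τ τ_e) (k m)⁻¹)⁻¹ · (k s τ k⁻¹ · (k e′ k⁻¹)) = k · (ψ_{s τ τ_e}(m)⁻¹ · (ē₂ n_e)) · k⁻¹`, `ψ_g(m) = g⁻¹ m g m⁻¹`. [cite: vanDijk1972, §2] -/
theorem newton_bracket_eq (s k m τ τe eb eb₂ ne : ↥(unitaryGroupOfForm σ J)) (heb₂ : τe * eb₂ = eb * τe) :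
    (k * m * s * (τ * τe) * (k * m)⁻¹)⁻¹ * (k * s * τ * k⁻¹ * (k * (eb * τe * ne) * k⁻¹)) =
      k * (((s * (τ * τe))⁻¹ * m * (s * (τ * τe)) * m⁻¹)⁻¹ * (eb₂ * ne)) * k⁻¹ := by
  have h1 : eb * τe * ne = τe * eb₂ * ne := by rw [← heb₂]
  rw [h1]
  group

omit [ValuativeRel K] [Invertible (2 : K)] in
/-- **`ψ_{sc}(m) = (c⁻¹ ψ_s(m) c) · (c⁻¹ m c m⁻¹)`** (free-group identity). [cite: vanDijk1972, §2] -/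
theorem twist_mul_right_eq (s c m : ↥(unitaryGroupOfForm σ J)) :
    (s * c)⁻¹ * m * (s * c) * m⁻¹ = (c⁻¹ * (s⁻¹ * m * s * m⁻¹) * c) * (c⁻¹ * m * c * m⁻¹) := by
  group

/-! ## §2 The Newton step -/

include hσ in
/-- **(J5b) NEWTON STEP.**  See the module docstring: from `k ∈ K_γ`, `τ ∈ T ∩ K_γ`, an error `e ∈ K_δ` and the radii bookkeeping, produce `k′ ∈ K_γ`, `τ′ ∈ T ∩ K_γ` with
`(k′ s τ′ k′⁻¹)⁻¹ · (k s τ k⁻¹ · e) ∈ K_{μ·γ}`. [cite: HarishChandra1970, Lemma 22] [cite: vanDijk1972, §2] [cite: Casselman1995, Prop. 1.4.4] -/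
theorem exists_refine_conj_approx (hv : ∀ x, valuation K (σ x) = valuation K x)
    (s : ↥(torusU σ J)) (hreg : IsRegularElt ((s : ↥(unitaryGroupOfForm σ J)) : GL (Fin 3) K))
    {d : Fin 3 → Kˣ} (hd : glDiagonal 3 K d = ((s : ↥(unitaryGroupOfForm σ J)) : GL (Fin 3) K))
    {γ δ μ ρx ρy ρx' ρy' : ValueGroupWithZero K} (hγ1 : γ ≤ 1) (hδ1 : δ < 1) (h2δ : valuation K (⅟(2 : K)) * δ ≤ 1) (hδγ : δ ≤ γ) (hμγ : μ ≤ γ)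
    (hρxμ : ρx ≤ μ) (hρyμ : ρy ≤ μ) (hρx'μ : ρx' ≤ μ) (hρy'μ : ρy' ≤ μ)
    (hρxδ : valuation K ((((d 0)⁻¹ * d 1 : Kˣ) : K) - 1) * ρx = δ) (hρyδ : valuation K ((((d 0)⁻¹ * d 2 : Kˣ) : K) - 1) * ρy = δ)
    (hρx'δ : valuation K ((((d 2)⁻¹ * d 1 : Kˣ) : K) - 1) * ρx' = δ) (hρy'δ : valuation K ((((d 2)⁻¹ * d 0 : Kˣ) : K) - 1) * ρy' = δ)
    (hρ : valuation K (⅟(2 : K)) * valuation K ((((d 0)⁻¹ * d 1 : Kˣ) : K) - σ (((d 0)⁻¹ * d 1 : Kˣ) : K)) * (ρx * ρx) ≤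
      valuation K ((((d 0)⁻¹ * d 2 : Kˣ) : K) - 1) * ρy)
    (hρw : valuation K (⅟(2 : K)) * valuation K ((((d 2)⁻¹ * d 1 : Kˣ) : K) - σ (((d 2)⁻¹ * d 1 : Kˣ) : K)) * (ρx' * ρx') ≤
      valuation K ((((d 2)⁻¹ * d 0 : Kˣ) : K) - 1) * ρy')
    (hδμ : δ ≤ μ) (h2μ : valuation K (⅟(2 : K)) * μ ≤ 1)
    (hL1rev : ∀ (η : ValueGroupWithZero K) (n : ↥(unipotentU σ J)), valuation K (⅟(2 : K)) * η ≤ 1 →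
      valuation K (heisX σ n) ≤ η → valuation K (heisY σ hσ hJ n : K) ≤ η →
        (n : ↥(unitaryGroupOfForm σ J)) ∈ (congruenceGL 3 η).comap (unitaryGroupOfForm σ J).subtype)
    {k : ↥(unitaryGroupOfForm σ J)} (hk : k ∈ (congruenceGL 3 γ).comap (unitaryGroupOfForm σ J).subtype)
    {τ : ↥(unitaryGroupOfForm σ J)} (hτK : τ ∈ (congruenceGL 3 γ).comap (unitaryGroupOfForm σ J).subtype) (hτT : τ ∈ torusU σ J)
    {e : ↥(unitaryGroupOfForm σ J)} (he : e ∈ (congruenceGL 3 δ).comap (unitaryGroupOfForm σ J).subtype) :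
    ∃ k' ∈ (congruenceGL 3 γ).comap (unitaryGroupOfForm σ J).subtype, ∃ τ' ∈ (congruenceGL 3 γ).comap (unitaryGroupOfForm σ J).subtype, τ' ∈ torusU σ J ∧
      (k' * s * τ' * k'⁻¹)⁻¹ * (k * s * τ * k⁻¹ * e) ∈ (congruenceGL 3 (μ * γ)).comap (unitaryGroupOfForm σ J).subtype := by
  have hw₀ : (((weylLongU σ hJ : ↥(unitaryGroupOfForm σ J)) : GL (Fin 3) K) : Matrix (Fin 3) (Fin 3) K) = J := coe_coe_weylLongU σ hJ
  have hwinv : (weylLongU σ hJ)⁻¹ = weylLongU σ hJ := (eq_inv_of_mul_eq_one_left (weylLongU_mul_weylLongU σ hJ)).symm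
  have hwI : weylLongU σ hJ ∈ (glInt 3 K).comap (unitaryGroupOfForm σ J).subtype := weylLongU_mem_comap_glInt σ hJ
  have hK0 : ∀ {η : ValueGroupWithZero K} {g : ↥(unitaryGroupOfForm σ J)}, g ∈ (congruenceGL 3 η).comap (unitaryGroupOfForm σ J).subtype →
      g ∈ (glInt 3 K).comap (unitaryGroupOfForm σ J).subtype :=
    fun hg => Subgroup.comap_mono (congruenceGL_le_glInt _) hg
  -- (1) the conjugated error and its Iwahori factorisation at level `δ`: `k⁻¹ e k = ē · ne · τe`, `ē = w₀ m₀ w₀⁻¹`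
  have he' : k⁻¹ * e * k ∈ (congruenceGL 3 δ).comap (unitaryGroupOfForm σ J).subtype := by
    have := conj_mem_comap_congruenceGL_of_mem_comap_glInt (unitaryGroupOfForm σ J).subtype
      (((glInt 3 K).comap (unitaryGroupOfForm σ J).subtype).inv_mem (hK0 hk)) he
    simpa only [inv_inv] using this
  obtain ⟨m₀, ne, τe, hm₀K, hneK, hτeK, hτeT, hfac⟩ := exists_nbar_unipotent_eq_of_mem σ hJ hδ1 he'
  -- `ne₂ := τe⁻¹ ne τe ∈ N ∩ K_δ`, so that `k⁻¹ e k = ē · τe · ne₂`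
  have hne₂N : τe⁻¹ * (ne : ↥(unitaryGroupOfForm σ J)) * τe ∈ unipotentU σ J := by
    have h := (borelU_le_normalizer σ J) (torusU_le_borelU σ J ((torusU σ J).inv_mem hτeT))
    rw [Subgroup.mem_normalizer_iff] at h
    have := (h (ne : ↥(unitaryGroupOfForm σ J))).1 ne.2
    simpa only [inv_inv] using this
  obtain ⟨ne₂, hne₂⟩ : ∃ ne₂ : ↥(unipotentU σ J), (ne₂ : ↥(unitaryGroupOfForm σ J)) = τe⁻¹ * (ne : ↥(unitaryGroupOfForm σ J)) * τe :=
    ⟨⟨_, hne₂N⟩, rfl⟩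
  have hne₂K : (ne₂ : ↥(unitaryGroupOfForm σ J)) ∈ (congruenceGL 3 δ).comap (unitaryGroupOfForm σ J).subtype := by
    rw [hne₂]
    have := conj_mem_comap_congruenceGL_of_mem_comap_glInt (unitaryGroupOfForm σ J).subtype
      (((glInt 3 K).comap (unitaryGroupOfForm σ J).subtype).inv_mem (hK0 hτeK)) hneK
    simpa only [inv_inv] using this
  -- (2) `ē₂ := τe⁻¹ ē τe = w₀ m₂ w₀⁻¹` with `m₂ ∈ N ∩ K_δ`
  have hτew : (weylLongU σ hJ)⁻¹ * τe⁻¹ * weylLongU σ hJ ∈ torusU σ J := by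
    have h := weyl_conj_mem_torusU_of_mem σ hJ hw₀ ((torusU σ J).inv_mem hτeT)
    rw [hwinv] at h ⊢
    exact h
  have hm₂N : ((weylLongU σ hJ)⁻¹ * τe⁻¹ * weylLongU σ hJ) * (m₀ : ↥(unitaryGroupOfForm σ J)) * ((weylLongU σ hJ)⁻¹ * τe⁻¹ * weylLongU σ hJ)⁻¹ ∈
      unipotentU σ J := by
    have h := (borelU_le_normalizer σ J) (torusU_le_borelU σ J hτew)
    rw [Subgroup.mem_normalizer_iff] at h
    exact (h (m₀ : ↥(unitaryGroupOfForm σ J))).1 m₀.2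
  obtain ⟨m₂, hm₂⟩ : ∃ m₂ : ↥(unipotentU σ J), (m₂ : ↥(unitaryGroupOfForm σ J)) =
      ((weylLongU σ hJ)⁻¹ * τe⁻¹ * weylLongU σ hJ) * (m₀ : ↥(unitaryGroupOfForm σ J)) * ((weylLongU σ hJ)⁻¹ * τe⁻¹ * weylLongU σ hJ)⁻¹ :=
    ⟨⟨_, hm₂N⟩, rfl⟩
  have hm₂K : (m₂ : ↥(unitaryGroupOfForm σ J)) ∈ (congruenceGL 3 δ).comap (unitaryGroupOfForm σ J).subtype := by
    rw [hm₂]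
    refine conj_mem_comap_congruenceGL_of_mem_comap_glInt (unitaryGroupOfForm σ J).subtype ?_ hm₀K
    exact Subgroup.mul_mem _ (Subgroup.mul_mem _ (Subgroup.inv_mem _ hwI) (Subgroup.inv_mem _ (hK0 hτeK))) hwI
  have heb₂ : τe * (weylLongU σ hJ * (m₂ : ↥(unitaryGroupOfForm σ J)) * (weylLongU σ hJ)⁻¹) =
      (weylLongU σ hJ * (m₀ : ↥(unitaryGroupOfForm σ J)) * (weylLongU σ hJ)⁻¹) * τe := by
    rw [hm₂]
    group
  -- (3) boxes of `ne₂` and `m₂` (level `δ`, (L1) forward)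
  have hne₂x := valuation_heisX_le_of_mem σ ne₂ hne₂K
  have hne₂y := valuation_heisY_le_of_mem σ hσ hJ hv h2δ ne₂ hne₂K
  have hm₂x := valuation_heisX_le_of_mem σ m₂ hm₂K
  have hm₂y := valuation_heisY_le_of_mem σ hσ hJ hv h2δ m₂ hm₂K
  -- (4) preimages under the twists: ★ (J3) and ★ (J3⁻) surjOn
  have hsurjN := surjOn_vanDijk_box σ hσ hJ (valuation K) hv s hreg hd hρ
  have hne₂tgt : ne₂ ∈ {n : ↥(unipotentU σ J) | valuation K (heisX σ n) ≤ valuation K ((((d 0)⁻¹ * d 1 : Kˣ) : K) - 1) * ρx ∧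
      valuation K (heisY σ hσ hJ n : K) ≤ valuation K ((((d 0)⁻¹ * d 2 : Kˣ) : K) - 1) * ρy} := by
    refine ⟨?_, ?_⟩
    · rw [hρxδ]; exact hne₂x
    · rw [hρyδ]; exact hne₂y
  obtain ⟨n₁, ⟨hn₁x, hn₁y⟩, hn₁eq⟩ := hsurjN hne₂tgt
  have hn₁eq' : torusConj σ s n₁ * n₁⁻¹ = ne₂ := hn₁eq
  have hbijNbar := bijOn_weylConj_vanDijk_box σ hσ hJ (valuation K) hv (weylLongU σ hJ) hw₀ s hreg hd hρw
  have heb₂tgt : weylLongU σ hJ * (m₂ : ↥(unitaryGroupOfForm σ J)) * (weylLongU σ hJ)⁻¹ ∈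
      (fun n : ↥(unipotentU σ J) => weylLongU σ hJ * (n : ↥(unitaryGroupOfForm σ J)) * (weylLongU σ hJ)⁻¹) ''
        {n | valuation K (heisX σ n) ≤ valuation K ((((d 2)⁻¹ * d 1 : Kˣ) : K) - 1) * ρx' ∧
          valuation K (heisY σ hσ hJ n : K) ≤ valuation K ((((d 2)⁻¹ * d 0 : Kˣ) : K) - 1) * ρy'} := by
    refine ⟨m₂, ⟨?_, ?_⟩, rfl⟩
    · rw [hρx'δ]; exact hm₂x
    · rw [hρy'δ]; exact hm₂y
  obtain ⟨nb₁, ⟨m₁, ⟨hm₁x, hm₁y⟩, hm₁eq⟩, hnb₁eq⟩ := hbijNbar.surjOn heb₂tgt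
  have hnb₁eq' : (s : ↥(unitaryGroupOfForm σ J))⁻¹ * nb₁ * s * nb₁⁻¹ =
      weylLongU σ hJ * (m₂ : ↥(unitaryGroupOfForm σ J)) * (weylLongU σ hJ)⁻¹ := hnb₁eq
  have hm₁eq' : weylLongU σ hJ * (m₁ : ↥(unitaryGroupOfForm σ J)) * (weylLongU σ hJ)⁻¹ = nb₁ := hm₁eq
  -- (5) levels of the corrections: `n₁, nb₁ ∈ K_μ`
  have hn₁K : (n₁ : ↥(unitaryGroupOfForm σ J)) ∈ (congruenceGL 3 μ).comap (unitaryGroupOfForm σ J).subtype :=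
    hL1rev μ n₁ h2μ (hn₁x.trans hρxμ) (hn₁y.trans hρyμ)
  have hm₁K : (m₁ : ↥(unitaryGroupOfForm σ J)) ∈ (congruenceGL 3 μ).comap (unitaryGroupOfForm σ J).subtype :=
    hL1rev μ m₁ h2μ (hm₁x.trans hρx'μ) (hm₁y.trans hρy'μ)
  have hnb₁K : nb₁ ∈ (congruenceGL 3 μ).comap (unitaryGroupOfForm σ J).subtype := by
    rw [← hm₁eq', hwinv]
    exact weylLongU_mul_mul_weylLongU_mem_comap_congruenceGL σ hJ hm₁K
  -- (6) the new data `k′ = k · (nb₁ n₁)`, `τ′ = τ τe`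
  have hm₃K : nb₁ * (n₁ : ↥(unitaryGroupOfForm σ J)) ∈ (congruenceGL 3 μ).comap (unitaryGroupOfForm σ J).subtype := Subgroup.mul_mem _ hnb₁K hn₁K
  have hμγK : (congruenceGL 3 μ).comap (unitaryGroupOfForm σ J).subtype ≤ (congruenceGL 3 γ).comap (unitaryGroupOfForm σ J).subtype :=
    Subgroup.comap_mono (congruenceGL_mono hμγ)
  have hδγK : (congruenceGL 3 δ).comap (unitaryGroupOfForm σ J).subtype ≤ (congruenceGL 3 γ).comap (unitaryGroupOfForm σ J).subtype :=
    Subgroup.comap_mono (congruenceGL_mono hδγ)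
  refine ⟨k * (nb₁ * (n₁ : ↥(unitaryGroupOfForm σ J))), Subgroup.mul_mem _ hk (hμγK hm₃K), τ * τe,
    Subgroup.mul_mem _ hτK (hδγK hτeK), (torusU σ J).mul_mem hτT hτeT, ?_⟩
  -- (7) the bracket identity: everything reduces to `ψ_{s(ττe)}(m₃)⁻¹ · (ē₂ ne₂)` conjugated by `k`
  have he_eq : e = k * ((weylLongU σ hJ * (m₀ : ↥(unitaryGroupOfForm σ J)) * (weylLongU σ hJ)⁻¹) * τe * (ne₂ : ↥(unitaryGroupOfForm σ J))) * k⁻¹ := by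
    rw [hne₂]
    calc e = k * (k⁻¹ * e * k) * k⁻¹ := by group
      _ = k * (weylLongU σ hJ * (m₀ : ↥(unitaryGroupOfForm σ J)) * (weylLongU σ hJ)⁻¹ * (ne : ↥(unitaryGroupOfForm σ J)) * τe) * k⁻¹ := by rw [hfac]
      _ = _ := by group
  rw [he_eq, newton_bracket_eq σ (s : ↥(unitaryGroupOfForm σ J)) k (nb₁ * (n₁ : ↥(unitaryGroupOfForm σ J))) τ τe
    (weylLongU σ hJ * (m₀ : ↥(unitaryGroupOfForm σ J)) * (weylLongU σ hJ)⁻¹)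
    (weylLongU σ hJ * (m₂ : ↥(unitaryGroupOfForm σ J)) * (weylLongU σ hJ)⁻¹) (ne₂ : ↥(unitaryGroupOfForm σ J)) heb₂]
  -- levels used below
  have hτcK : τ * τe ∈ (congruenceGL 3 γ).comap (unitaryGroupOfForm σ J).subtype := Subgroup.mul_mem _ hτK (hδγK hτeK)
  have hμδγμ : (congruenceGL 3 (μ * δ)).comap (unitaryGroupOfForm σ J).subtype ≤ (congruenceGL 3 (μ * γ)).comap (unitaryGroupOfForm σ J).subtype :=
    Subgroup.comap_mono (congruenceGL_mono (mul_le_mul' le_rfl hδγ))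
  have hγδγμ : (congruenceGL 3 (γ * δ)).comap (unitaryGroupOfForm σ J).subtype ≤ (congruenceGL 3 (μ * γ)).comap (unitaryGroupOfForm σ J).subtype :=
    Subgroup.comap_mono (congruenceGL_mono (by rw [mul_comm μ γ]; exact mul_le_mul' le_rfl hδμ))
  have hγμγμ : (congruenceGL 3 (γ * μ)).comap (unitaryGroupOfForm σ J).subtype ≤ (congruenceGL 3 (μ * γ)).comap (unitaryGroupOfForm σ J).subtype :=
    Subgroup.comap_mono (congruenceGL_mono (by rw [mul_comm]))
  have hμδδ : (congruenceGL 3 (μ * δ)).comap (unitaryGroupOfForm σ J).subtype ≤ (congruenceGL 3 δ).comap (unitaryGroupOfForm σ J).subtype :=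
    Subgroup.comap_mono (congruenceGL_mono (by
      calc μ * δ ≤ 1 * δ := mul_le_mul' (hμγ.trans hγ1) le_rfl
        _ = δ := one_mul δ))
  -- (8) `ψ_s(m₃) = ψ_s(nb₁) · (nb₁ ψ_s(n₁) nb₁⁻¹) = ē₂ · (ne₂ · j₂)`
  have hψn₁ : (s : ↥(unitaryGroupOfForm σ J))⁻¹ * (n₁ : ↥(unitaryGroupOfForm σ J)) * s * (n₁ : ↥(unitaryGroupOfForm σ J))⁻¹ =
      (ne₂ : ↥(unitaryGroupOfForm σ J)) := by
    rw [← hn₁eq', Subgroup.coe_mul, Subgroup.coe_inv, coe_torusConj]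
  obtain ⟨j₂, hj₂, hj₂eq⟩ := exists_mem_comap_congruenceGL_conj_eq_mul (unitaryGroupOfForm σ J).subtype hnb₁K hne₂K
  have hψm₃ : (s : ↥(unitaryGroupOfForm σ J))⁻¹ * (nb₁ * (n₁ : ↥(unitaryGroupOfForm σ J))) * s * (nb₁ * (n₁ : ↥(unitaryGroupOfForm σ J)))⁻¹ =
      (weylLongU σ hJ * (m₂ : ↥(unitaryGroupOfForm σ J)) * (weylLongU σ hJ)⁻¹) * ((ne₂ : ↥(unitaryGroupOfForm σ J)) * j₂) := by
    rw [twist_mul_eq σ (s : ↥(unitaryGroupOfForm σ J)) nb₁ (n₁ : ↥(unitaryGroupOfForm σ J)), hψn₁, hnb₁eq', hj₂eq]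
  have heb₂K : weylLongU σ hJ * (m₂ : ↥(unitaryGroupOfForm σ J)) * (weylLongU σ hJ)⁻¹ ∈ (congruenceGL 3 δ).comap (unitaryGroupOfForm σ J).subtype := by
    rw [hwinv]
    exact weylLongU_mul_mul_weylLongU_mem_comap_congruenceGL σ hJ hm₂K
  have hψm₃K : (s : ↥(unitaryGroupOfForm σ J))⁻¹ * (nb₁ * (n₁ : ↥(unitaryGroupOfForm σ J))) * s * (nb₁ * (n₁ : ↥(unitaryGroupOfForm σ J)))⁻¹ ∈
      (congruenceGL 3 δ).comap (unitaryGroupOfForm σ J).subtype := by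
    rw [hψm₃]
    exact Subgroup.mul_mem _ heb₂K (Subgroup.mul_mem _ hne₂K (hμδδ hj₂))
  -- (9) `ψ_{sc}(m₃) = (c⁻¹ ψ_s(m₃) c)(c⁻¹ m₃ c m₃⁻¹)`, `c = τ τe`: the first factor is `ψ_s(m₃) j₄`, the second lies in `K_{γμ}`
  have hcinvK : (τ * τe)⁻¹ ∈ (congruenceGL 3 γ).comap (unitaryGroupOfForm σ J).subtype := Subgroup.inv_mem _ hτcK
  obtain ⟨j₄, hj₄, hj₄eq⟩ := exists_mem_comap_congruenceGL_conj_eq_mul (unitaryGroupOfForm σ J).subtype hcinvK hψm₃K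
  rw [inv_inv] at hj₄eq
  have hj₅ : (τ * τe)⁻¹ * (nb₁ * (n₁ : ↥(unitaryGroupOfForm σ J))) * (τ * τe) * (nb₁ * (n₁ : ↥(unitaryGroupOfForm σ J)))⁻¹ ∈
      (congruenceGL 3 (γ * μ)).comap (unitaryGroupOfForm σ J).subtype := by
    have := commutator_mem_comap_congruenceGL (unitaryGroupOfForm σ J).subtype hcinvK hm₃K
    simpa only [inv_inv] using this
  have hψsc : ((s : ↥(unitaryGroupOfForm σ J)) * (τ * τe))⁻¹ * (nb₁ * (n₁ : ↥(unitaryGroupOfForm σ J))) * ((s : ↥(unitaryGroupOfForm σ J)) * (τ * τe)) *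
        (nb₁ * (n₁ : ↥(unitaryGroupOfForm σ J)))⁻¹ =
      ((weylLongU σ hJ * (m₂ : ↥(unitaryGroupOfForm σ J)) * (weylLongU σ hJ)⁻¹) * ((ne₂ : ↥(unitaryGroupOfForm σ J)) * j₂) * j₄) *
        ((τ * τe)⁻¹ * (nb₁ * (n₁ : ↥(unitaryGroupOfForm σ J))) * (τ * τe) * (nb₁ * (n₁ : ↥(unitaryGroupOfForm σ J)))⁻¹) := by
    rw [twist_mul_right_eq σ (s : ↥(unitaryGroupOfForm σ J)) (τ * τe) (nb₁ * (n₁ : ↥(unitaryGroupOfForm σ J))), hj₄eq, hψm₃]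
  -- (10) the bracket is `j₅⁻¹ j₄⁻¹ j₂⁻¹ ∈ K_{μγ}`, and conjugation by `k ∈ K_γ` preserves the level
  have hbr : (((s : ↥(unitaryGroupOfForm σ J)) * (τ * τe))⁻¹ * (nb₁ * (n₁ : ↥(unitaryGroupOfForm σ J))) * ((s : ↥(unitaryGroupOfForm σ J)) * (τ * τe)) *
        (nb₁ * (n₁ : ↥(unitaryGroupOfForm σ J)))⁻¹)⁻¹ *
        ((weylLongU σ hJ * (m₂ : ↥(unitaryGroupOfForm σ J)) * (weylLongU σ hJ)⁻¹) * (ne₂ : ↥(unitaryGroupOfForm σ J))) =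
      ((τ * τe)⁻¹ * (nb₁ * (n₁ : ↥(unitaryGroupOfForm σ J))) * (τ * τe) * (nb₁ * (n₁ : ↥(unitaryGroupOfForm σ J)))⁻¹)⁻¹ * j₄⁻¹ * j₂⁻¹ := by
    rw [hψsc]
    group
  rw [hbr]
  refine conj_mem_comap_congruenceGL (unitaryGroupOfForm σ J).subtype hk ?_
  exact Subgroup.mul_mem _ (Subgroup.mul_mem _ (Subgroup.inv_mem _ (hγμγμ hj₅)) (Subgroup.inv_mem _ (hγδγμ hj₄))) (Subgroup.inv_mem _ (hμδγμ hj₂))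

/-! ## §3 The base case: level-`ε` solvability on `s·P̃` -/

omit [ValuativeRel K] [Invertible (2 : K)] in
/-- `s⁻¹ (n̄ n s c n⁻¹ n̄⁻¹) = ψ_s(n̄) · n̄ (ψ_s(n) · (n c n⁻¹)) n̄⁻¹` (free-group identity; the (J4c) decomposition). [cite: vanDijk1972, §2] -/
theorem inv_mul_conj_prod_eq (s nb n c : ↥(unitaryGroupOfForm σ J)) :
    s⁻¹ * (nb * n * s * c * (nb * n)⁻¹) = (s⁻¹ * nb * s * nb⁻¹) * (nb * ((s⁻¹ * n * s * n⁻¹) * (n * c * n⁻¹)) * nb⁻¹) := by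
  group

include hσ in
/-- **(J5a₀) BASE CASE: every point of `s·P̃` is hit at level `ε`.**  For `p = b̄ · c · b · e` with `b̄ ∈ Bbar`, `c ∈ K_γ ∩ T`, `b ∈ B`, `e ∈ K_ε`, where the carriers of
`B`, `Bbar` lie INSIDE the image boxes of the twists (hypotheses `hBsub`, `hBbarsub`; (J2)∕(J4a) give equality), there are `k ∈ K_γ`, `τ ∈ T ∩ K_γ` with
`(k s τ k⁻¹)⁻¹ · (s p) ∈ K_ε`: take `k := n̄ n` with `ψ_s(n̄) = b̄`, `ψ_s(n) = b` (★ (J3)(J3⁻) surjOn at radius `γ`) and `τ := c`; the error is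
`j′⁻¹ j⁻¹ ⁅c⁻¹, b⁻¹⁆ e` with `j ∈ K_{γ²}`, `j′, ⁅c⁻¹, b⁻¹⁆ ∈ K_{γγ′}` (★ (L5)), all in `K_ε` (`γ ≤ γ′`, `γγ′ ≤ ε`). [cite: HarishChandra1970, Lemma 22] [cite: vanDijk1972, §2] -/
theorem exists_conj_approx_base (hv : ∀ x, valuation K (σ x) = valuation K x)
    (s : ↥(torusU σ J)) (hreg : IsRegularElt ((s : ↥(unitaryGroupOfForm σ J)) : GL (Fin 3) K))
    {d : Fin 3 → Kˣ} (hd : glDiagonal 3 K d = ((s : ↥(unitaryGroupOfForm σ J)) : GL (Fin 3) K))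
    {γ γ' ε : ValueGroupWithZero K} (hγ1 : γ ≤ 1) (hγγ' : γ ≤ γ') (hε : γ * γ' ≤ ε)
    (hρ : valuation K (⅟(2 : K)) * valuation K ((((d 0)⁻¹ * d 1 : Kˣ) : K) - σ (((d 0)⁻¹ * d 1 : Kˣ) : K)) * (γ * γ) ≤
      valuation K ((((d 0)⁻¹ * d 2 : Kˣ) : K) - 1) * γ)
    (hρw : valuation K (⅟(2 : K)) * valuation K ((((d 2)⁻¹ * d 1 : Kˣ) : K) - σ (((d 2)⁻¹ * d 1 : Kˣ) : K)) * (γ * γ) ≤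
      valuation K ((((d 2)⁻¹ * d 0 : Kˣ) : K) - 1) * γ)
    (hL1rev : ∀ n : ↥(unipotentU σ J), valuation K (heisX σ n) ≤ γ → valuation K (heisY σ hσ hJ n : K) ≤ γ →
      (n : ↥(unitaryGroupOfForm σ J)) ∈ (congruenceGL 3 γ).comap (unitaryGroupOfForm σ J).subtype)
    (B Bbar : Subgroup ↥(unitaryGroupOfForm σ J))
    (hBK : B ≤ (congruenceGL 3 γ').comap (unitaryGroupOfForm σ J).subtype)
    (hBsub : ∀ g ∈ B, ∃ n : ↥(unipotentU σ J), (n : ↥(unitaryGroupOfForm σ J)) = g ∧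
      valuation K (heisX σ n) ≤ valuation K ((((d 0)⁻¹ * d 1 : Kˣ) : K) - 1) * γ ∧
        valuation K (heisY σ hσ hJ n : K) ≤ valuation K ((((d 0)⁻¹ * d 2 : Kˣ) : K) - 1) * γ)
    (hBbarsub : ∀ g ∈ Bbar, ∃ m : ↥(unipotentU σ J), weylLongU σ hJ * (m : ↥(unitaryGroupOfForm σ J)) * (weylLongU σ hJ)⁻¹ = g ∧
      valuation K (heisX σ m) ≤ valuation K ((((d 2)⁻¹ * d 1 : Kˣ) : K) - 1) * γ ∧
        valuation K (heisY σ hσ hJ m : K) ≤ valuation K ((((d 2)⁻¹ * d 0 : Kˣ) : K) - 1) * γ)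
    {bb c b e : ↥(unitaryGroupOfForm σ J)} (hbb : bb ∈ Bbar)
    (hcK : c ∈ (congruenceGL 3 γ).comap (unitaryGroupOfForm σ J).subtype) (hcT : c ∈ torusU σ J) (hb : b ∈ B)
    (he : e ∈ (congruenceGL 3 ε).comap (unitaryGroupOfForm σ J).subtype) :
    ∃ k ∈ (congruenceGL 3 γ).comap (unitaryGroupOfForm σ J).subtype, ∃ τ ∈ (congruenceGL 3 γ).comap (unitaryGroupOfForm σ J).subtype, τ ∈ torusU σ J ∧
      (k * s * τ * k⁻¹)⁻¹ * ((s : ↥(unitaryGroupOfForm σ J)) * (bb * c * b * e)) ∈ (congruenceGL 3 ε).comap (unitaryGroupOfForm σ J).subtype := by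
  have hw₀ : (((weylLongU σ hJ : ↥(unitaryGroupOfForm σ J)) : GL (Fin 3) K) : Matrix (Fin 3) (Fin 3) K) = J := coe_coe_weylLongU σ hJ
  have hwinv : (weylLongU σ hJ)⁻¹ = weylLongU σ hJ := (eq_inv_of_mul_eq_one_left (weylLongU_mul_weylLongU σ hJ)).symm
  have hγγK : (congruenceGL 3 (γ * γ)).comap (unitaryGroupOfForm σ J).subtype ≤ (congruenceGL 3 ε).comap (unitaryGroupOfForm σ J).subtype :=
    Subgroup.comap_mono (congruenceGL_mono ((mul_le_mul' le_rfl hγγ').trans hε))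
  have hγγ'K : (congruenceGL 3 (γ * γ')).comap (unitaryGroupOfForm σ J).subtype ≤ (congruenceGL 3 ε).comap (unitaryGroupOfForm σ J).subtype :=
    Subgroup.comap_mono (congruenceGL_mono hε)
  have hγK : (congruenceGL 3 γ).comap (unitaryGroupOfForm σ J).subtype ≤ (congruenceGL 3 γ').comap (unitaryGroupOfForm σ J).subtype := Subgroup.comap_mono (congruenceGL_mono hγγ')
  -- preimages: `ψ_s(n) = b`, `ψ_s(n̄) = b̄`
  obtain ⟨nb₀, hnb₀, hbx, hby⟩ := hBsub b hb
  have hsurjN := surjOn_vanDijk_box σ hσ hJ (valuation K) hv s hreg hd hρ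
  obtain ⟨n, ⟨hnx, hny⟩, hneq⟩ := hsurjN (show nb₀ ∈ {n' : ↥(unipotentU σ J) | _ ∧ _} from ⟨hbx, hby⟩)
  have hneq' : torusConj σ s n * n⁻¹ = nb₀ := hneq
  have hψn : (s : ↥(unitaryGroupOfForm σ J))⁻¹ * (n : ↥(unitaryGroupOfForm σ J)) * s * (n : ↥(unitaryGroupOfForm σ J))⁻¹ = b := by
    rw [← hnb₀, ← hneq', Subgroup.coe_mul, Subgroup.coe_inv, coe_torusConj]
  obtain ⟨m₀, hm₀, hm₀x, hm₀y⟩ := hBbarsub bb hbb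
  have hbij := bijOn_weylConj_vanDijk_box σ hσ hJ (valuation K) hv (weylLongU σ hJ) hw₀ s hreg hd hρw
  obtain ⟨nb, ⟨m', ⟨hm'x, hm'y⟩, hm'eq⟩, hnbeq⟩ := hbij.surjOn (show bb ∈ (fun n' : ↥(unipotentU σ J) =>
      weylLongU σ hJ * (n' : ↥(unitaryGroupOfForm σ J)) * (weylLongU σ hJ)⁻¹) '' {n' | _ ∧ _} from ⟨m₀, ⟨hm₀x, hm₀y⟩, hm₀⟩)
  have hnbeq' : (s : ↥(unitaryGroupOfForm σ J))⁻¹ * nb * s * nb⁻¹ = bb := hnbeq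
  have hm'eq' : weylLongU σ hJ * (m' : ↥(unitaryGroupOfForm σ J)) * (weylLongU σ hJ)⁻¹ = nb := hm'eq
  -- levels of the preimages
  have hnK : (n : ↥(unitaryGroupOfForm σ J)) ∈ (congruenceGL 3 γ).comap (unitaryGroupOfForm σ J).subtype := hL1rev n hnx hny
  have hnbK : nb ∈ (congruenceGL 3 γ).comap (unitaryGroupOfForm σ J).subtype := by
    rw [← hm'eq', hwinv]
    exact weylLongU_mul_mul_weylLongU_mem_comap_congruenceGL σ hJ (hL1rev m' hm'x hm'y)
  refine ⟨nb * (n : ↥(unitaryGroupOfForm σ J)), Subgroup.mul_mem _ hnbK hnK, c, hcK, hcT, ?_⟩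
  -- the computation
  obtain ⟨j, hj, hjeq⟩ := exists_mem_comap_congruenceGL_conj_eq_mul (unitaryGroupOfForm σ J).subtype hnK hcK
  have hjγ : j ∈ (congruenceGL 3 γ).comap (unitaryGroupOfForm σ J).subtype :=
    Subgroup.comap_mono (congruenceGL_mono (by
      calc γ * γ ≤ γ * 1 := mul_le_mul' le_rfl hγ1
        _ = γ := mul_one γ)) hj
  have hXK : b * (c * j) ∈ (congruenceGL 3 γ').comap (unitaryGroupOfForm σ J).subtype :=
    Subgroup.mul_mem _ (hBK hb) (hγK (Subgroup.mul_mem _ hcK hjγ))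
  obtain ⟨j', hj', hj'eq⟩ := exists_mem_comap_congruenceGL_conj_eq_mul (unitaryGroupOfForm σ J).subtype hnbK hXK
  have hdec := inv_mul_conj_prod_eq σ (s : ↥(unitaryGroupOfForm σ J)) nb (n : ↥(unitaryGroupOfForm σ J)) c
  rw [hψn, hnbeq', hjeq, hj'eq] at hdec
  have hconj : nb * (n : ↥(unitaryGroupOfForm σ J)) * s * c * (nb * (n : ↥(unitaryGroupOfForm σ J)))⁻¹ = (s : ↥(unitaryGroupOfForm σ J)) * (bb * (b * (c * j) * j')) := by
    calc nb * (n : ↥(unitaryGroupOfForm σ J)) * s * c * (nb * (n : ↥(unitaryGroupOfForm σ J)))⁻¹ = (s : ↥(unitaryGroupOfForm σ J)) * ((s : ↥(unitaryGroupOfForm σ J))⁻¹ * (nb * (n : ↥(unitaryGroupOfForm σ J)) * s * c * (nb * (n : ↥(unitaryGroupOfForm σ J)))⁻¹)) := by group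
      _ = (s : ↥(unitaryGroupOfForm σ J)) * (bb * (b * (c * j) * j')) := by rw [hdec]
  rw [hconj]
  have hfin : ((s : ↥(unitaryGroupOfForm σ J)) * (bb * (b * (c * j) * j')))⁻¹ * ((s : ↥(unitaryGroupOfForm σ J)) * (bb * c * b * e)) = j'⁻¹ * j⁻¹ * (c⁻¹ * b⁻¹ * c⁻¹⁻¹ * b⁻¹⁻¹) * e := by
    group
  rw [hfin]
  have hcomm : c⁻¹ * b⁻¹ * c⁻¹⁻¹ * b⁻¹⁻¹ ∈ (congruenceGL 3 (γ * γ')).comap (unitaryGroupOfForm σ J).subtype :=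
    commutator_mem_comap_congruenceGL (unitaryGroupOfForm σ J).subtype (Subgroup.inv_mem _ hcK) (Subgroup.inv_mem _ (hBK hb))
  exact Subgroup.mul_mem _ (Subgroup.mul_mem _ (Subgroup.mul_mem _ (Subgroup.inv_mem _ (hγγ'K hj')) (Subgroup.inv_mem _ (hγγK hj))) (hγγ'K hcomm)) he

end Summit.HodgeConjecture.HodgeConjecture.Cruxes.H413.F0P3cStCharTSTubeNewtonStep
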